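import Summits.BirchSwinnertonDyer.BirchSwinnertonDyer.Theorems.KatoDescentPotSupersingularReducibleFineSelmerMirrorThree
import Literature.NumberTheory.EllipticCurves.DivisionFieldReducibleBorelRootOfUnity
import Literature.NumberTheory.EllipticCurves.DivisionFieldReducibleBorelIndex
import Mathlib.NumberTheory.Cyclotomic.PrimitiveRoots
import HarnessLib

/-!
# (A) at `p = 3` on EVERY reducible row from «`μ₃ = 0` for imaginary quadratic fields» — the intrinsic form: the Galois data of
# the Borel field are DISCHARGED (route-free helper for crux M = stmt-BirchSwinnertonDyer-19196 `ReducibleKatoMember`, K9 / K8-t′;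
# seat `bsd-potss-rkm` g36)

WHY.  The companion `…ReducibleFineSelmerMirrorThree` (this seat, p707213) gives Coates–Sujatha's (A) at `(W, 3)` from `μ₃ = 0` of the
imaginary quadratic mirror of the Borel field `L = ℚ(χ₁, χ₂)`, with the Galois data of `L` DISPLAYED (`z, b, ζ₃, …`).  Here they are
DISCHARGED from «`W[3]` reducible» alone, using three facts about `L` now in the tree: `ζ₃ ∈ L` and `Gal(L/ℚ)` is killed by `2`
(`DivisionFieldReducibleBorelRootOfUnity`, Weil pairing), `[L : ℚ] ∣ 4` (`DivisionFieldReducibleBorelIndex`, the character pair).  The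
complex conjugation `z` is the `IsConj` partner of an embedding (Mathlib), `b` generates `Gal(L/ℚ(ζ₃))` (order `≤ 2`), and the mirror
`L^{⟨zb⟩}` is `ℚ` (cyclotomic-Borel rows, `[L:ℚ] = 2`) or an IMAGINARY QUADRATIC field (`[L:ℚ] = 4`).  RESULT:

* `fineSelmerDual_moduleFinite_three_of_not_irreducible_of_imaginaryQuadratic` — **for every `W/ℚ` with `W[3]` reducible and every
  cyclotomic `ℤ₃`-extension, statement (A) at `3` holds GIVEN ONLY `H_IQ` := «`μ = 0` (growth form) for every cyclotomic
  `ℤ₃`-extension of every imaginary quadratic field» (a degree-`2`, not totally real number field)** — the hypothesis is stated inline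
  (no new named fact); it is the imaginary-quadratic instance of Ferrero–Washington (Ferrero 1978), and
* `imaginaryQuadratic_mu_of_FW` — `H_IQ` follows from the tree's FW fact in one line (so nothing here is weaker than before); hence
* on EVERY reducible row at `p = 3` (all 9476 K9 X3 r0 classes) the `μ`-input of crux M's chain is `H_IQ`, i.e. FW for IMAGINARY
  QUADRATIC fields only — the real/even half being Leopoldt–Scholz reflection IN THE KERNEL (`IwasawaTheory/ClassicalMuVanishesReflection*`).

HONEST FRAMING.  Theorems only; route-free; closes nothing (crux M stays cite-level over Fine, H2X⁺, modularity and — class-wide at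
`p = 3` — `H_IQ` ⊂ FW); BSD is proved for no curve.  References: [Lang1990] Ch. 13 §2 Thm. 2.1 (i); [Washington1997] §10.2, §13.3,
§7.5; [Serre1972] §4; [SilvermanAEC2009] III.8.1; [CoatesSujatha2005] Cor. 3.6; [Wuthrich2014] L. 14; [Ferrero1978]; [FerreroWashington1979].
-/

-- the summit and its single problem are both named `BirchSwinnertonDyer` (registry layout D-0017)
set_option linter.dupNamespace false
set_option autoImplicit false

noncomputable section

open scoped Classical NumberField ComplexConjugate
open Field NumberField NumberField.InfinitePlace NumberField.ComplexEmbedding IsDedekindDomain IntermediateField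
  WeierstrassCurve
open Literature.NumberTheory.EllipticCurves Literature.NumberTheory.EllipticCurves.GreenbergSelmer
open Literature.NumberTheory.GaloisRepresentations Literature.NumberTheory.IwasawaTheory
open Summit.BirchSwinnertonDyer.BirchSwinnertonDyer.Theorems

namespace Summit.BirchSwinnertonDyer.BirchSwinnertonDyer.Theorems.ReducibleFineSelmerImaginaryQuadraticThree

/-- `finrank_ℚ` does not depend on the `ℚ`-module structure (there is only one). [folklore] -/
private theorem finrank_rat_congr {M : Type} [AddCommGroup M] {i₁ : Module ℚ M} (i₂ : Module ℚ M) {n : ℕ}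
    (h : @Module.finrank ℚ M _ _ i₁ = n) : @Module.finrank ℚ M _ _ i₂ = n := by
  obtain rfl : i₁ = i₂ := Subsingleton.elim _ _
  exact h

/-- `IsCyclotomicExtension S ℚ L` does not depend on the `ℚ`-algebra structure (there is only one). [folklore] -/
private theorem isCyclotomicExtension_rat_congr {S : Set ℕ} {L : Type} [Field L] {i₁ : Algebra ℚ L} (i₂ : Algebra ℚ L)
    (h : @IsCyclotomicExtension S ℚ L _ _ i₁) : @IsCyclotomicExtension S ℚ L _ _ i₂ := by
  obtain rfl : i₁ = i₂ := Subsingleton.elim _ _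
  exact h

/-! ## §1 A field with a primitive `n`-th root of unity, `n > 2`, is totally complex -/

/-- A number field containing a primitive `n`-th root of unity with `2 < n` is totally complex (a real embedding would send it
to a real root of unity, i.e. `±1`). [cite: Washington1997, Ch. 2 (ℚ(ζ_n) is totally complex for n > 2)] -/
theorem isTotallyComplex_of_isPrimitiveRoot {L : Type} [Field L] [NumberField L] {n : ℕ} {ζ : L} (hζ : IsPrimitiveRoot ζ n)
    (hn : 2 < n) : IsTotallyComplex L := by
  refine ⟨fun w => ?_⟩
  rw [← not_isReal_iff_isComplex, ← mk_embedding w, isReal_mk_iff]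
  intro hφ
  have hζ' : IsPrimitiveRoot (w.embedding ζ) n := hζ.map_of_injective w.embedding.injective
  have hreal : (starRingEnd ℂ) (w.embedding ζ) = w.embedding ζ := RingHom.congr_fun (ComplexEmbedding.isReal_iff.mp hφ) ζ
  have hnorm : ‖w.embedding ζ‖ = 1 := Complex.norm_eq_one_of_pow_eq_one hζ'.pow_eq_one (by omega)
  have hinv : (w.embedding ζ)⁻¹ = w.embedding ζ := by rw [Complex.inv_eq_conj hnorm, hreal]
  have hsq : w.embedding ζ ^ 2 = 1 := by
    have h0 : w.embedding ζ ≠ 0 := hζ'.ne_zero (by omega)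
    calc w.embedding ζ ^ 2 = w.embedding ζ * (w.embedding ζ)⁻¹ := by rw [sq, hinv]
      _ = 1 := mul_inv_cancel₀ h0
  have hdvd := hζ'.dvd_of_pow_eq_one 2 hsq
  have : n ≤ 2 := Nat.le_of_dvd two_pos hdvd
  omega

/-! ## §2 The Galois data of a field `L/ℚ` with `ζ₃ ∈ L`, `Gal(L/ℚ)` killed by `2` and `[L:ℚ] ∣ 4` -/

set_option maxHeartbeats 800000 in
/-- **Reflection data of a CM (bi)quadratic field with `ζ₃`.**  `L/ℚ` finite Galois with every element of `Gal(L/ℚ)` squaring to `1`,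
`[L : ℚ] ∣ 4`, and `ζ ∈ L` a primitive cube root of unity.  Then `L` is totally complex and there are commuting involutions `z, b`
generating `Gal(L/ℚ)`, `z ≠ 1` the complex conjugation (so `L^{⟨z⟩}` is totally real), `L^{⟨b⟩} = ℚ(ζ)` a `3`rd cyclotomic extension of
`ℚ`, and the mirror `L^{⟨zb⟩}` is either `ℚ` (`[L:ℚ] = 2`) or an IMAGINARY QUADRATIC field (`[L:ℚ] = 4`: degree `2`, not totally real).
(`z` is the `IsConj` partner of a complex embedding, embedding-independent because the group is commutative; `b` generates
`Gal(L/ℚ(ζ))`, which has index `2` since `Gal(L/ℚ)` moves `ζ` inside `{ζ, ζ²}`.) [cite: Washington1997, §10.2 (proof of Thm. 10.10: K = ℚ(√d, √−3) and its subfields)] -/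
theorem exists_reflectionData_three (L : Type) [Field L] [NumberField L] [Algebra ℚ L] [FiniteDimensional ℚ L] [IsGalois ℚ L]
    (hexp : ∀ g : L ≃ₐ[ℚ] L, g * g = 1) (hdeg : Module.finrank ℚ L ∣ 4) {ζ : L} (hζ : IsPrimitiveRoot ζ 3) :
    IsTotallyComplex L ∧ ∃ z b : L ≃ₐ[ℚ] L, z * z = 1 ∧ b * b = 1 ∧ z * b = b * z ∧ z ≠ 1 ∧
      Subgroup.closure ({z, b} : Set (L ≃ₐ[ℚ] L)) = ⊤ ∧ IsTotallyReal ↥(fixedField (Subgroup.zpowers z)) ∧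
      IsCyclotomicExtension {3} ℚ ↥(fixedField (Subgroup.zpowers b)) ∧
      (fixedField (Subgroup.zpowers (z * b)) = ⊥ ∨
        (Module.finrank ℚ ↥(fixedField (Subgroup.zpowers (z * b))) = 2 ∧
          ¬ IsTotallyReal ↥(fixedField (Subgroup.zpowers (z * b))))) := by
  haveI : NeZero (3 : ℕ) := ⟨by decide⟩
  haveI hTC : IsTotallyComplex L := isTotallyComplex_of_isPrimitiveRoot hζ (by norm_num)
  refine ⟨hTC, ?_⟩
  -- the group is commutative
  have hinv : ∀ g : L ≃ₐ[ℚ] L, g⁻¹ = g := fun g => inv_eq_of_mul_eq_one_right (hexp g)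
  have hcomm : ∀ g h : L ≃ₐ[ℚ] L, g * h = h * g := fun g h => by
    calc g * h = (g * h)⁻¹ := (hinv _).symm
      _ = h⁻¹ * g⁻¹ := mul_inv_rev g h
      _ = h * g := by rw [hinv, hinv]
  have hcardG : Nat.card (L ≃ₐ[ℚ] L) = Module.finrank ℚ L := IsGalois.card_aut_eq_finrank ℚ L
  -- complex conjugation `z`
  obtain ⟨φ⟩ : Nonempty (L →+* ℂ) := inferInstance
  have hφ : ¬ ComplexEmbedding.IsReal φ := IsTotallyComplex.complexEmbedding_not_isReal φ
  obtain ⟨z, hz⟩ : ∃ z : L ≃ₐ[ℚ] L, IsConj φ z :=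
    exists_isConj_of_isRamified <| isRamified_iff.mpr ⟨IsTotallyComplex.isComplex _, IsTotallyReal.isReal _⟩
  have hzall : ∀ ψ : L →+* ℂ, IsConj ψ z := by
    intro ψ
    obtain ⟨ν, rfl⟩ := exists_comp_symm_eq_of_comp_eq (k := ℚ) φ ψ (Subsingleton.elim _ _)
    have h := hz.comp ν.symm
    rwa [hcomm _ z, mul_assoc, inv_mul_cancel, mul_one] at h
  have hz1 : z ≠ 1 := (isConj_ne_one_iff hz).mpr hφ
  have hzz : z * z = 1 := hexp z
  -- `L^{⟨z⟩}` is totally real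
  have hreal : IsTotallyReal ↥(fixedField (Subgroup.zpowers z)) := by
    have : Finite (Subgroup.zpowers z) := inferInstance
    refine ⟨fun w => ?_⟩
    obtain ⟨W', rfl⟩ := w.comap_surjective (K := L)
    dsimp only
    rw [← mk_embedding W', comap_mk, isReal_mk_iff]
    exact ComplexEmbedding.IsConj.isReal_comp
      (σ := IsGaloisGroup.mulEquivAlgEquiv (Subgroup.zpowers z)
        (FixedPoints.intermediateField (Subgroup.zpowers z) : IntermediateField ℚ L) L ⟨z, Subgroup.mem_zpowers z⟩)
      (hzall W'.embedding)
  -- `z ζ = ζ²`: complex conjugation inverts roots of unity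
  have hζφ : IsPrimitiveRoot (φ ζ) 3 := hζ.map_of_injective φ.injective
  have hconj_ne : (starRingEnd ℂ) (φ ζ) ≠ φ ζ := by
    intro h1
    obtain ⟨r, hr⟩ := Complex.conj_eq_iff_real.mp h1
    have hr3 : r ^ 3 = 1 := by
      have := hζφ.pow_eq_one
      rw [hr] at this
      exact_mod_cast this
    have hr1 : r = 1 := (Odd.strictMono_pow (by decide : Odd 3)).injective (by simpa using hr3)
    exact hζφ.ne_one (by norm_num) (by rw [hr, hr1]; simp)
  have hzζ : z ζ ≠ ζ := by
    intro h
    apply hconj_ne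
    rw [starRingEnd_apply, ← hz.eq ζ, h]
  -- every `g` moves `ζ` inside `{ζ, ζ²}`
  have hmove : ∀ g : L ≃ₐ[ℚ] L, g ζ = ζ ∨ g ζ = ζ ^ 2 := by
    intro g
    have h3 : (g ζ) ^ 3 = 1 := by rw [← map_pow, hζ.pow_eq_one, map_one]
    obtain ⟨i, hi, hgi⟩ := hζ.eq_pow_of_pow_eq_one h3
    interval_cases i
    · exfalso
      rw [pow_zero] at hgi
      have : ζ = 1 := g.injective (by rw [← hgi, map_one])
      exact hζ.ne_one (by norm_num) this
    · exact Or.inl (by rw [← hgi, pow_one])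
    · exact Or.inr hgi.symm
  have hζ2 : ζ ^ 2 ≠ ζ := by
    intro h
    have : ζ = 1 := by
      have h' : ζ * ζ = ζ * 1 := by rw [mul_one, ← sq, h]
      exact mul_left_cancel₀ (hζ.ne_zero (by norm_num)) h'
    exact hζ.ne_one (by norm_num) this
  have hzζ2 : z ζ = ζ ^ 2 := (hmove z).resolve_left hzζ
  -- the cyclotomic subfield `ℚ(ζ)` and `H = Gal(L/ℚ(ζ))`, of index `2`
  set E₃ : IntermediateField ℚ L := IntermediateField.adjoin ℚ {ζ} with hE₃
  set H : Subgroup (L ≃ₐ[ℚ] L) := E₃.fixingSubgroup with hH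
  have hfixH : fixedField H = E₃ := IsGalois.fixedField_fixingSubgroup E₃
  have hmemH : ∀ g : L ≃ₐ[ℚ] L, g ∈ H ↔ g ζ = ζ := by
    intro g
    rw [hH, IntermediateField.mem_fixingSubgroup_iff]
    constructor
    · intro h; exact h ζ (mem_adjoin_simple_self ℚ ζ)
    · intro h x hx
      have hle : E₃ ≤ fixedField (Subgroup.zpowers g) := by
        rw [hE₃, adjoin_simple_le_iff, IntermediateField.mem_fixedField_iff]
        intro f hf
        exact (Subgroup.zpowers_le.mpr (show g ∈ MulAction.stabilizer (L ≃ₐ[ℚ] L) ζ from h)) hf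
      have hx' := hle hx
      rw [IntermediateField.mem_fixedField_iff] at hx'
      exact hx' g (Subgroup.mem_zpowers g)
  have hzH : z ∉ H := fun h => hzζ ((hmemH z).mp h)
  have hindex : H.index = 2 := by
    rw [Subgroup.index_eq_two_iff]
    refine ⟨z, fun g => ?_⟩
    by_cases hg : g ∈ H
    · refine Or.inr ⟨hg, fun hgz => hzH ?_⟩
      have : z = g⁻¹ * (g * z) := by group
      rw [this]
      exact H.mul_mem (H.inv_mem hg) hgz
    · refine Or.inl ⟨?_, hg⟩
      rw [hmemH]
      have hgζ : g ζ = ζ ^ 2 := (hmove g).resolve_left (fun h => hg ((hmemH g).mpr h))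
      rw [AlgEquiv.mul_apply, hzζ2, map_pow, hgζ, ← pow_mul]
      have : ζ ^ (2 * 2) = ζ ^ 3 * ζ := by ring
      rw [this, hζ.pow_eq_one, one_mul]
  have hHcard : Nat.card H * 2 = Nat.card (L ≃ₐ[ℚ] L) := by rw [← hindex, Subgroup.card_mul_index]
  -- the cyclotomic structure on `L^H = ℚ(ζ)` (transported to the default `ℚ`-algebra structure)
  have hcycE : ∀ (E : IntermediateField ℚ L), E = E₃ → IsCyclotomicExtension {3} ℚ ↥E := by
    rintro E rfl
    exact isCyclotomicExtension_rat_congr _ (hζ.intermediateField_adjoin_isCyclotomicExtension ℚ)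
  -- `#H ∈ {1, 2}`
  have hHdvd : Nat.card H * 2 ∣ 4 := by rw [hHcard, hcardG]; exact hdeg
  have hHdvd' : Nat.card H ∣ 2 := Nat.dvd_of_mul_dvd_mul_right two_pos (by simpa using hHdvd)
  rcases (Nat.dvd_prime Nat.prime_two).mp hHdvd' with hH1 | hH2
  · /- `[L:ℚ] = 2`: `L = ℚ(ζ)`, `b = 1`, mirror `= L^{⟨z⟩} = ℚ` -/
    have hG2 : Nat.card (L ≃ₐ[ℚ] L) = 2 := by rw [← hHcard, hH1]
    have hzp : Subgroup.zpowers z = ⊤ := by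
      apply Subgroup.eq_top_of_card_eq
      rw [Nat.card_zpowers, orderOf_eq_prime (by rw [pow_two]; exact hzz) hz1, hG2]
    have hHbot : H = ⊥ := by
      rw [← Subgroup.card_eq_one, hH1]
    refine ⟨z, 1, hzz, mul_one 1, by rw [mul_one, one_mul], hz1, ?_, hreal, ?_, Or.inl ?_⟩
    · rw [eq_top_iff, ← hzp]
      exact (Subgroup.zpowers_le (G := L ≃ₐ[ℚ] L)).mpr (Subgroup.subset_closure (Set.mem_insert z {1}))
    · refine hcycE _ ?_
      rw [Subgroup.zpowers_one_eq_bot, ← hHbot, hfixH]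
    · rw [mul_one, hzp, IsGalois.fixedField_top]
  · /- `[L:ℚ] = 4`: `H = ⟨b⟩` of order `2`, mirror imaginary quadratic -/
    have hG4 : Nat.card (L ≃ₐ[ℚ] L) = 4 := by rw [← hHcard, hH2]
    have hLdeg : Module.finrank ℚ L = 4 := by rw [← hcardG, hG4]
    obtain ⟨b, hbH, hb1⟩ : ∃ b ∈ H, b ≠ 1 := by
      by_contra hcon
      push Not at hcon
      have : H = ⊥ := (Subgroup.eq_bot_iff_forall _).mpr hcon
      rw [this, Subgroup.card_bot] at hH2
      exact absurd hH2 (by norm_num)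
    have hbb : b * b = 1 := hexp b
    have hzpb : Subgroup.zpowers b = H := by
      apply Subgroup.eq_of_le_of_card_ge ((Subgroup.zpowers_le (G := L ≃ₐ[ℚ] L)).mpr hbH)
      rw [hH2, Nat.card_zpowers, orderOf_eq_prime (by rw [pow_two]; exact hbb) hb1]
    have hzb1 : z * b ≠ 1 := by
      intro h
      have : z = b := by
        calc z = z * (b * b) := by rw [hbb, mul_one]
          _ = (z * b) * b := by rw [mul_assoc]
          _ = b := by rw [h, one_mul]
      exact hzH (this ▸ hbH)
    have hzbzb : (z * b) * (z * b) = 1 := hexp _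
    refine ⟨z, b, hzz, hbb, hcomm z b, hz1, ?_, hreal, ?_, Or.inr ⟨?_, ?_⟩⟩
    · -- `closure {z, b} = ⊤`
      have hHS : H ≤ Subgroup.closure ({z, b} : Set (L ≃ₐ[ℚ] L)) := by
        rw [← hzpb]
        exact (Subgroup.zpowers_le (G := L ≃ₐ[ℚ] L)).mpr (Subgroup.subset_closure (Set.mem_insert_of_mem z rfl))
      have hzS : z ∈ Subgroup.closure ({z, b} : Set (L ≃ₐ[ℚ] L)) := Subgroup.subset_closure (Set.mem_insert z {b})
      have hSdvd : Nat.card (Subgroup.closure ({z, b} : Set (L ≃ₐ[ℚ] L))) ∣ 4 := by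
        have := Subgroup.card_subgroup_dvd_card (Subgroup.closure ({z, b} : Set (L ≃ₐ[ℚ] L))); rwa [hG4] at this
      have h2S : 2 ∣ Nat.card (Subgroup.closure ({z, b} : Set (L ≃ₐ[ℚ] L))) := by
        have := Subgroup.card_dvd_of_le hHS; rwa [hH2] at this
      have hS2 : Nat.card (Subgroup.closure ({z, b} : Set (L ≃ₐ[ℚ] L))) ≠ 2 := by
        intro h2
        have hHS' : H = Subgroup.closure ({z, b} : Set (L ≃ₐ[ℚ] L)) :=
          Subgroup.eq_of_le_of_card_ge hHS (by rw [h2, hH2])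
        exact hzH (hHS' ▸ hzS)
      have hS4 : Nat.card (Subgroup.closure ({z, b} : Set (L ≃ₐ[ℚ] L))) = 4 := by
        have h4 : (4 : ℕ) = 2 ^ 2 := by norm_num
        rw [h4] at hSdvd
        obtain ⟨i, hi, hSi⟩ := (Nat.dvd_prime_pow Nat.prime_two).mp hSdvd
        interval_cases i
        · exfalso
          rw [hSi] at h2S
          norm_num at h2S
        · exfalso; exact hS2 (by rw [hSi]; norm_num)
        · rw [hSi]; norm_num
      exact Subgroup.eq_top_of_card_eq _ (by rw [hS4, hG4])
    · -- `L^{⟨b⟩} = ℚ(ζ)`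
      exact hcycE _ (by rw [hzpb, hfixH])
    · -- the mirror has degree `2`
      have h := finrank_fixedField_eq_card (Subgroup.zpowers (z * b)) (E := L) (F := ℚ)
      rw [Nat.card_zpowers, orderOf_eq_prime (by rw [pow_two]; exact hzbzb) hzb1] at h
      have htower := Module.finrank_mul_finrank ℚ ↥(fixedField (Subgroup.zpowers (z * b))) L
      rw [h, hLdeg] at htower
      omega
    · -- the mirror is not totally real: otherwise `z` fixes it, so `z ∈ ⟨zb⟩ = {1, zb}`
      intro hMreal
      have hfixM : ∀ x : L, x ∈ fixedField (Subgroup.zpowers (z * b)) → z x = x := by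
        intro x hx
        have hψ : ComplexEmbedding.IsReal (φ.comp (algebraMap ↥(fixedField (Subgroup.zpowers (z * b))) L)) := by
          have := hMreal.isReal (InfinitePlace.mk (φ.comp (algebraMap ↥(fixedField (Subgroup.zpowers (z * b))) L)))
          rwa [isReal_mk_iff] at this
        have h1 : (starRingEnd ℂ) (φ x) = φ x := by
          have := RingHom.congr_fun (ComplexEmbedding.isReal_iff.mp hψ) ⟨x, hx⟩
          simpa using this
        apply φ.injective
        rw [hz.eq x, ← starRingEnd_apply]
        exact h1
      have hzM : z ∈ (fixedField (Subgroup.zpowers (z * b))).fixingSubgroup :=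
        (IntermediateField.mem_fixingSubgroup_iff _ z).mpr hfixM
      rw [IntermediateField.fixingSubgroup_fixedField] at hzM
      obtain ⟨k, hk⟩ := Subgroup.mem_zpowers_iff.mp hzM
      have hzpow : ∀ n : ℕ, (z * b) ^ n = 1 ∨ (z * b) ^ n = z * b := by
        intro n
        induction n with
        | zero => exact Or.inl (pow_zero _)
        | succ n ih =>
          rcases ih with h | h
          · exact Or.inr (by rw [pow_succ, h, one_mul])
          · exact Or.inl (by rw [pow_succ, h, hzbzb])
      have hzint : ∀ m : ℤ, (z * b) ^ m = 1 ∨ (z * b) ^ m = z * b := by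
        intro m
        obtain ⟨n, rfl | rfl⟩ := Int.eq_nat_or_neg m
        · rw [zpow_natCast]; exact hzpow n
        · rw [zpow_neg, zpow_natCast]
          rcases hzpow n with h | h
          · exact Or.inl (by rw [h, inv_one])
          · exact Or.inr (by rw [h, hinv])
      rcases hzint k with h | h
      · exact hz1 (hk.symm.trans h)
      · have hzzb : z = z * b := hk.symm.trans h
        apply hb1
        calc b = z * (z * b) := by rw [← mul_assoc, hzz, one_mul]
          _ = z * z := by rw [← hzzb]
          _ = 1 := hzz

/-! ## §3 (A) at `3` on every reducible row from `μ₃ = 0` of the imaginary quadratic fields -/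

/-- **(A) at `(W, 3)` for EVERY `W/ℚ` with `W[3]` reducible, from «`μ₃ = 0` for every cyclotomic `ℤ₃`-extension of every imaginary
quadratic field» ALONE** (stated inline as `hIQ`: number fields of degree `2` that are not totally real).  The Galois data of the
Borel field are discharged by `exists_reflectionData_three` (with `ζ₃ ∈ L`, `Gal(L/ℚ)` of exponent `2`, `[L:ℚ] ∣ 4` from the tree);
the mirror input is `hIQ` in the biquadratic case and `μ(ℚ) = 0` (`classicalMuVanishes_rat`) in the cyclotomic-Borel case.
[cite: CoatesSujatha2005, Cor. 3.6] [cite: Wuthrich2014, Lemma 14 (p. 396)] [cite: Lang1990, Ch. 13 §2, Thm. 2.1 (i)]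
[cite: Washington1997, §10.2 Thm. 10.10 (Scholz)] -/
theorem fineSelmerDual_moduleFinite_three_of_not_irreducible_of_imaginaryQuadratic
    (hIQ : ∀ (M : Type) [Field M] [NumberField M], Module.finrank ℚ M = 2 → ¬ IsTotallyReal M →
      ∀ κM : ZpExtension M 3, κM.IsCyclotomic → ClassicalMuVanishes κM)
    (W : WeierstrassCurve ℚ) [W.IsElliptic] (hred : ¬ W.HasIrreducibleModPGaloisRep 3)
    (κ : ZpExtension ℚ 3) (hκ : κ.IsCyclotomic) :
    ∃ (γ : absoluteGaloisGroup ℚ) (D : W.FineSelmerDualData κ γ),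
      Module.Finite ℤ_[3] (RestrictScalars ℤ_[3] (IwasawaAlgebra 3) D.X) := by
  haveI : NeZero (3 : ℕ) := ⟨by decide⟩
  -- a stable line
  obtain ⟨C, hC, h1, h2⟩ : ∃ C : AddSubgroup (W.geomTorsion ((3 : ℕ) : ℤ)),
      (∀ (σ : absoluteGaloisGroup ℚ) (x : W.geomTorsion ((3 : ℕ) : ℤ)), x ∈ C → σ • x ∈ C) ∧ C ≠ ⊥ ∧ C ≠ ⊤ := by
    unfold HasIrreducibleModPGaloisRep at hred
    push Not at hred
    obtain ⟨C, hC, h1, h2⟩ := hred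
    exact ⟨C, hC, h1, h2⟩
  -- the Borel field and its Galois data
  haveI : FiniteDimensional ℚ (W.borelField C) := finiteDimensional_borelField C
  haveI : IsGalois ℚ (W.borelField C) := isGalois_borelField hC
  haveI : NumberField (W.borelField C) := NumberField.mk
  obtain ⟨ζ, hζ⟩ := W.exists_isPrimitiveRoot_borelField C h1 h2
  have hexp : ∀ g : ↥(W.borelField C) ≃ₐ[ℚ] ↥(W.borelField C), g * g = 1 :=
    W.mul_self_eq_one_of_gal_borelField_three hC h1 h2
  have hdeg : Module.finrank ℚ ↥(W.borelField C) ∣ 4 := by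
    simpa using W.finrank_borelField_dvd (p := 3) hC h1 h2
  obtain ⟨hTC, z, b, hz, hb, hzb, hz1, htop, hreal, hcycb, hmirror⟩ :=
    exists_reflectionData_three ↥(W.borelField C) hexp hdeg hζ
  haveI := hTC
  haveI := hcycb
  have h3L : ¬ 3 ∣ Module.finrank ℚ ↥(W.borelField C) := fun h =>
    absurd (Nat.dvd_trans h hdeg) (by norm_num)
  refine ReducibleFineSelmerMirrorThree.fineSelmerDual_moduleFinite_three_of_imaginaryMirror W κ hκ C hC h1 h2 h3L hζ hz hb hzb
    hz1 htop hreal (fun κE hκE => ?_)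
  -- the mirror input
  rcases hmirror with hbot | ⟨hdeg2, hnr⟩
  · -- cyclotomic-Borel row: the mirror is `ℚ`
    have φ : ℚ ≃ₐ[ℚ] ↥(fixedField (Subgroup.zpowers (z * b))) :=
      (IntermediateField.botEquiv ℚ ↥(W.borelField C)).symm.trans (IntermediateField.equivOfEq hbot.symm)
    exact forall_classicalMuVanishes_of_algEquiv (F := ℚ) (p := 3) φ (by rw [Module.finrank_self]; decide)
      (fun κQ _ => classicalMuVanishes_rat κQ) κE hκE
  · -- biquadratic row: the mirror is imaginary quadratic
    haveI : NumberField ↥(fixedField (Subgroup.zpowers (z * b))) := NumberField.mk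
    exact hIQ ↥(fixedField (Subgroup.zpowers (z * b))) (finrank_rat_congr _ hdeg2) hnr κE hκE

/-- **`H_IQ` from Ferrero–Washington in one line** (an imaginary quadratic field is abelian over `ℚ`): the hypothesis of the
previous theorem is implied by the tree's FW fact, so nothing here is weaker than the FW road. [cite: Washington1997, §7.5 (Ferrero–Washington)] -/
theorem imaginaryQuadratic_mu_of_FW (hFW : ferreroWashington1979_classicalMuVanishes)
    (M : Type) [Field M] [NumberField M] (hM : Module.finrank ℚ M = 2) (_hnr : ¬ IsTotallyReal M)
    (κM : ZpExtension M 3) (hκM : κM.IsCyclotomic) : ClassicalMuVanishes κM := by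
  haveI : Fact (3 : ℕ).Prime := ⟨Nat.prime_three⟩
  haveI : Algebra.IsQuadraticExtension ℚ M := { toFree := Module.Free.of_divisionRing ℚ M, finrank_eq_two' := hM }
  haveI : IsGalois ℚ M := Algebra.IsQuadraticExtension.isGalois ℚ M
  have h2 : Nat.card (M ≃ₐ[ℚ] M) = 2 := by rw [IsGalois.card_aut_eq_finrank, hM]
  have hsq : ∀ g : M ≃ₐ[ℚ] M, g * g = 1 := fun g => by
    rw [← pow_two, ← h2]; exact pow_card_eq_one'
  have hinv : ∀ g : M ≃ₐ[ℚ] M, g⁻¹ = g := fun g => inv_eq_of_mul_eq_one_right (hsq g)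
  haveI : IsMulCommutative (M ≃ₐ[ℚ] M) := ⟨⟨fun a c => by
    calc a * c = (a * c)⁻¹ := (hinv _).symm
      _ = c⁻¹ * a⁻¹ := mul_inv_rev a c
      _ = c * a := by rw [hinv, hinv]⟩⟩
  haveI : IsAbelianGalois ℚ M := {}
  exact hFW M 3 κM hκM

/-- **Corollary: (A) at `3` on every reducible row, modulo Ferrero–Washington applied to IMAGINARY QUADRATIC fields only** (the
composite of the two theorems above; same conclusion as g34's `…_of_FW` at `p = 3`, with FW's use confined to degree-`2` non-real fields).
[cite: CoatesSujatha2005, Cor. 3.6] [cite: Washington1997, §7.5, §10.2 Thm. 10.10] -/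
theorem fineSelmerDual_moduleFinite_three_of_not_irreducible_of_FW_imaginaryQuadratic
    (hFW : ferreroWashington1979_classicalMuVanishes)
    (W : WeierstrassCurve ℚ) [W.IsElliptic] (hred : ¬ W.HasIrreducibleModPGaloisRep 3)
    (κ : ZpExtension ℚ 3) (hκ : κ.IsCyclotomic) :
    ∃ (γ : absoluteGaloisGroup ℚ) (D : W.FineSelmerDualData κ γ),
      Module.Finite ℤ_[3] (RestrictScalars ℤ_[3] (IwasawaAlgebra 3) D.X) :=
  fineSelmerDual_moduleFinite_three_of_not_irreducible_of_imaginaryQuadratic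
    (fun M _ _ hM hnr κM hκM => imaginaryQuadratic_mu_of_FW hFW M hM hnr κM hκM) W hred κ hκ

end Summit.BirchSwinnertonDyer.BirchSwinnertonDyer.Theorems.ReducibleFineSelmerImaginaryQuadraticThree

end
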